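import Literature.Analysis.FluidPDE.TorusPressurePoisson
import Literature.Analysis.FluidPDE.PassiveScalarWellPosednessProofs
import Literature.Analysis.FunctionSpaces.TorusDiffMonomialBounds
import Literature.Analysis.FunctionSpaces.LatticeSobolev
import Summits.AnomalousDissipation.AnomalousDissipation.Theorems.SawtoothPulseCascadeK1LocalisedCascadeFinalGlue

/-!
# K1loc, line `Spectral` / SeqCone — helper: EULERIAN CONVERSION (low horizontal modes of a modulated phase by one integration by parts)

Helper file of the prover lane on the crux `K1LocalisedCascade` (stmt-AnomalousDissipation-19491), route
`SawtoothPulseCascade`, registered stub `stub_highModeConcentration` (memo v7 §4, the "Lagrangian T4" road).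

The first-good-piece input of the S-C chain (T4 of memo v6, S-D) asks for an UPPER bound on the low-horizontal-mode
energy `E_{|k_i|<K}(w)` of the inviscid cascade profile `w = sin 2πψ` (`ψ = x₁ ∘ Φ⁻¹`) at a fixed phase.  The kinematic
(Lagrangian) information available from the tree's cone lemmas is a lower bound on the local horizontal frequency
`p = ∂ᵢψ` off a small set; this file supplies the EULERIAN half — the conversion of such information into a bound on the
low-mode energy — by a single integration by parts in the coordinate `xᵢ` (non-stationary phase):

* `abs_integral_phase_mul_le` — for smooth real `w, c, p, q, χ, g` with `∂ᵢc = −2π·p·w` (for `w = sin 2πψ` take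
  `c = cos 2πψ`, `p = ∂ᵢψ`), `|c| ≤ 1`, `q·p = 1` wherever `χ ≠ 0` (`q` = a smooth reciprocal of `p` on the good set), and
  `|χ q| ≤ S`:  `|∫ χ w g| ≤ (2π)⁻¹ (‖∂ᵢ(χq)‖₂ ‖g‖₂ + S ‖∂ᵢg‖₂)`;
* `lowModeEnergy_le_of_pairing` — duality: if `|∫ f g| ≤ A‖g‖₂ + S′‖∂ᵢg‖₂` for every smooth real `g`, then
  `Σ_{|k_i|<K} |𝓕f(k)|² ≤ (A + 2π K S′)²` (`K ≥ 0`; the maximiser is the real part of the low-block synthesis, whose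
  `xᵢ`-derivative costs at most `2πK` in `L²`);
* `lowModeEnergy_le_of_phase` — the two combined with the split `w = χw + (1−χ)w`:
  `Σ_{|k_i|<K} |𝓕w(k)|² ≤ ((2π)⁻¹‖∂ᵢ(χq)‖₂ + K·S + ‖(1−χ)w‖₂)²`.
  Reading: `S ≈ 1/inf_{supp χ}|∂ᵢψ|` (so `K·S` is the ratio threshold/local frequency), `‖∂ᵢ(χq)‖₂` collects the cut-off
  gradient over `|p|` and the relative chirp rate `|∂ᵢp|/p²`, and `‖(1−χ)w‖₂²` is the energy on the excised set.
The low-mode energy is written exactly as in `…FinalGlue.stub_form_of_lowModeEnergy_le`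
(`Σ' k, [|k_i| < K]·‖𝓕(↑w)(k)‖²`).

WHAT THIS IS NOT: no statement about the cascade or the stub; the Lagrangian inputs (`p` large off a small set, the
relative chirp rate bounded) are the consumer's.  Line-independent torus calculus.
[cite: Grafakos2014, Prop. 3.2.7 (3) (Parseval) and Prop. 3.1.2 (differentiation of Fourier series)]
[cite: Evans2010, App. C.2 Thm. 2 (integration by parts; no boundary on the torus)] [problem: turb]
-/

-- `Summit.<Summit>.<Problem>`: single-conjunct summit, the duplicate namespace segment is deliberate.
set_option linter.dupNamespace false

noncomputable section

namespace Summit.AnomalousDissipation.AnomalousDissipation.Theorems.SawtoothPulseCascade.K1Lagr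

open MeasureTheory Set Filter Topology UnitAddTorus Complex
open scoped ComplexConjugate
open Literature.Analysis Literature.Analysis.FunctionSpaces Literature.Analysis.FunctionSpaces.Torus
open Literature.Analysis.FluidPDE

variable {d : Type*} [Fintype d] [DecidableEq d]

/-! ## §1 One integration by parts against a modulated phase -/

/-- **Non-stationary phase, one integration by parts.**  Let `c, q, χ, g : T^d → ℝ` be smooth and `w, p` real with
`∂ᵢc = −2π·p·w` (e.g. `w = sin 2πψ`, `c = cos 2πψ`, `p = ∂ᵢψ`), `|c| ≤ 1`, `q·p = 1` wherever `χ ≠ 0`, and `|χ q| ≤ S`.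
Then `|∫ χ w g| ≤ (2π)⁻¹ (√∫(∂ᵢ(χq))² · √∫g² + S · √∫(∂ᵢg)²)`:
`χw = −(2π)⁻¹ χq ∂ᵢc`, integrate by parts (no boundary on the torus), and bound `|c| ≤ 1`.
[cite: Evans2010, App. C.2 Thm. 2] -/
theorem abs_integral_phase_mul_le {w c p q χ g : UnitAddTorus d → ℝ} (hc : IsSmooth c)
    (hq : IsSmooth q) (hχ : IsSmooth χ) (hg : IsSmooth g) (i : d)
    (hcw : ∀ x, partialDeriv i c x = -(2 * Real.pi) * p x * w x) (hc1 : ∀ x, |c x| ≤ 1)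
    (hqp : ∀ x, χ x ≠ 0 → q x * p x = 1) {S : ℝ} (hS : ∀ x, |χ x * q x| ≤ S) :
    |∫ x, χ x * w x * g x| ≤
      (2 * Real.pi)⁻¹ * (Real.sqrt (∫ x, (partialDeriv i (fun y => χ y * q y) x) ^ 2) * Real.sqrt (∫ x, g x ^ 2) +
        S * Real.sqrt (∫ x, (partialDeriv i g x) ^ 2)) := by
  have hπ : 0 < 2 * Real.pi := by positivity
  have hS0 : 0 ≤ S := (abs_nonneg _).trans (hS 0)
  -- `χ w = −(2π)⁻¹ χ q ∂ᵢc` pointwise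
  have hχq : IsSmooth (fun y => χ y * q y) := by unfold IsSmooth at hχ hq ⊢; exact hχ.mul hq
  have hχqg : IsSmooth (fun y => χ y * q y * g y) := by unfold IsSmooth at hχq hg ⊢; exact hχq.mul hg
  have hpt : ∀ x, χ x * w x * g x = -(2 * Real.pi)⁻¹ * (partialDeriv i c x * (χ x * q x * g x)) := by
    intro x
    by_cases hx : χ x = 0
    · simp [hx]
    · rw [hcw x]
      have h1 := hqp x hx
      rw [show -(2 * Real.pi)⁻¹ * (-(2 * Real.pi) * p x * w x * (χ x * q x * g x)) =
          ((2 * Real.pi)⁻¹ * (2 * Real.pi)) * (q x * p x) * (χ x * w x * g x) by ring,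
        inv_mul_cancel₀ (ne_of_gt hπ), h1]
      ring
  have hI : ∫ x, χ x * w x * g x = -(2 * Real.pi)⁻¹ * ∫ x, partialDeriv i c x * (χ x * q x * g x) := by
    rw [← integral_const_mul]
    exact integral_congr_ae (ae_of_all _ hpt)
  -- integrate by parts
  rw [hI, FluidPDE.Torus.integral_partialDeriv_mul_eq_neg_integral hc hχqg i]
  have hprod : ∀ x, partialDeriv i (fun y => χ y * q y * g y) x =
      (fun y => χ y * q y) x * partialDeriv i g x + partialDeriv i (fun y => χ y * q y) x * g x :=
    fun x => partialDeriv_mul (hχq.isContDiff (by simp)) (hg.isContDiff (by simp)) i x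
  simp_rw [hprod]
  have hc_cont := hc.continuous
  have hi1 : Integrable (fun x => c x * (χ x * q x * partialDeriv i g x)) volume :=
    (hc_cont.mul (hχq.continuous.mul (hg.partialDeriv i).continuous)).integrable_unitAddTorus
  have hi2 : Integrable (fun x => c x * (partialDeriv i (fun y => χ y * q y) x * g x)) volume :=
    (hc_cont.mul ((hχq.partialDeriv i).continuous.mul hg.continuous)).integrable_unitAddTorus
  have hsplit : ∫ x, c x * (χ x * q x * partialDeriv i g x + partialDeriv i (fun y => χ y * q y) x * g x) =
      (∫ x, c x * (χ x * q x * partialDeriv i g x)) + ∫ x, c x * (partialDeriv i (fun y => χ y * q y) x * g x) := by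
    rw [← integral_add hi1 hi2]
    exact integral_congr_ae (ae_of_all _ fun x => by ring)
  rw [hsplit]
  -- bounds on the two integrals
  have hb1 : |∫ x, c x * (χ x * q x * partialDeriv i g x)| ≤ S * Real.sqrt (∫ x, (partialDeriv i g x) ^ 2) := by
    have hle : ∀ x, |c x * (χ x * q x * partialDeriv i g x)| ≤ S * |partialDeriv i g x| := fun x => by
      rw [abs_mul, abs_mul]
      calc |c x| * (|χ x * q x| * |partialDeriv i g x|) ≤ 1 * (S * |partialDeriv i g x|) :=
            mul_le_mul (hc1 x) (mul_le_mul_of_nonneg_right (hS x) (abs_nonneg _)) (by positivity) zero_le_one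
        _ = S * |partialDeriv i g x| := one_mul _
    have hcont : Continuous fun x => |partialDeriv i g x| := (hg.partialDeriv i).continuous.abs
    calc |∫ x, c x * (χ x * q x * partialDeriv i g x)| ≤ ∫ x, |c x * (χ x * q x * partialDeriv i g x)| :=
          abs_integral_le_integral_abs
      _ ≤ ∫ x, S * |partialDeriv i g x| :=
          integral_mono hi1.abs ((hcont.const_smul S).integrable_unitAddTorus.congr (ae_of_all _ fun x => by simp)) hle
      _ = S * ∫ x, 1 * |partialDeriv i g x| := by rw [integral_const_mul]; simp
      _ ≤ S * (Real.sqrt (∫ x, (1 : ℝ) ^ 2) * Real.sqrt (∫ x, |partialDeriv i g x| ^ 2)) :=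
          mul_le_mul_of_nonneg_left (integral_mul_le_sqrt_mul_sqrt continuous_const hcont) hS0
      _ = S * Real.sqrt (∫ x, (partialDeriv i g x) ^ 2) := by simp [sq_abs]
  have hb2 : |∫ x, c x * (partialDeriv i (fun y => χ y * q y) x * g x)| ≤
      Real.sqrt (∫ x, (partialDeriv i (fun y => χ y * q y) x) ^ 2) * Real.sqrt (∫ x, g x ^ 2) := by
    have hle : ∀ x, |c x * (partialDeriv i (fun y => χ y * q y) x * g x)| ≤
        |partialDeriv i (fun y => χ y * q y) x| * |g x| := fun x => by
      rw [abs_mul, abs_mul]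
      calc |c x| * (|partialDeriv i (fun y => χ y * q y) x| * |g x|) ≤ 1 * (|partialDeriv i (fun y => χ y * q y) x| * |g x|) :=
            mul_le_mul_of_nonneg_right (hc1 x) (by positivity)
        _ = _ := one_mul _
    have hc1' : Continuous fun x => |partialDeriv i (fun y => χ y * q y) x| := (hχq.partialDeriv i).continuous.abs
    have hc2' : Continuous fun x => |g x| := hg.continuous.abs
    calc |∫ x, c x * (partialDeriv i (fun y => χ y * q y) x * g x)|
        ≤ ∫ x, |c x * (partialDeriv i (fun y => χ y * q y) x * g x)| := abs_integral_le_integral_abs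
      _ ≤ ∫ x, |partialDeriv i (fun y => χ y * q y) x| * |g x| :=
          integral_mono hi2.abs (hc1'.mul hc2').integrable_unitAddTorus hle
      _ ≤ Real.sqrt (∫ x, |partialDeriv i (fun y => χ y * q y) x| ^ 2) * Real.sqrt (∫ x, |g x| ^ 2) :=
          integral_mul_le_sqrt_mul_sqrt hc1' hc2'
      _ = Real.sqrt (∫ x, (partialDeriv i (fun y => χ y * q y) x) ^ 2) * Real.sqrt (∫ x, g x ^ 2) := by
          simp [sq_abs]
  calc |-(2 * Real.pi)⁻¹ * -((∫ x, c x * (χ x * q x * partialDeriv i g x)) +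
          ∫ x, c x * (partialDeriv i (fun y => χ y * q y) x * g x))|
      = (2 * Real.pi)⁻¹ * |(∫ x, c x * (χ x * q x * partialDeriv i g x)) +
          ∫ x, c x * (partialDeriv i (fun y => χ y * q y) x * g x)| := by
        rw [abs_mul, abs_neg, abs_neg, abs_of_pos (inv_pos.mpr hπ)]
    _ ≤ (2 * Real.pi)⁻¹ * (S * Real.sqrt (∫ x, (partialDeriv i g x) ^ 2) +
          Real.sqrt (∫ x, (partialDeriv i (fun y => χ y * q y) x) ^ 2) * Real.sqrt (∫ x, g x ^ 2)) :=
        mul_le_mul_of_nonneg_left ((abs_add_le _ _).trans (add_le_add hb1 hb2)) (inv_pos.mpr hπ).le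
    _ = _ := by ring

/-! ## §2 Duality: the low horizontal block -/

/-- **The low block by duality.**  Let `f : T^d → ℝ` be smooth, `K ≥ 0`, and suppose
`|∫ f g| ≤ A‖g‖₂ + S′‖∂ᵢ g‖₂` for every smooth real `g`.  Then `Σ_{|k_i|<K} |𝓕f(k)|² ≤ (A + 2πK·S′)²`:
test against the real part of the synthesis of the low block of `𝓕f`, whose `L²` norm is `√E_low` and whose
`xᵢ`-derivative has `L²` norm `≤ 2πK √E_low`. [cite: Grafakos2014, Prop. 3.2.7 (3) and Prop. 3.1.2] -/
theorem lowModeEnergy_le_of_pairing {f : UnitAddTorus d → ℝ} (hf : IsSmooth f) (i : d) {K : ℝ} (hK : 0 ≤ K)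
    {A S' : ℝ} (hA : 0 ≤ A) (hS' : 0 ≤ S')
    (hpair : ∀ g : UnitAddTorus d → ℝ, IsSmooth g →
      |∫ x, f x * g x| ≤ A * Real.sqrt (∫ x, g x ^ 2) + S' * Real.sqrt (∫ x, (partialDeriv i g x) ^ 2)) :
    ∑' k : d → ℤ, (if |((k i : ℤ) : ℝ)| < K then (1 : ℝ) else 0) * ‖mFourierCoeff (fun x => (f x : ℂ)) k‖ ^ 2 ≤
      (A + 2 * Real.pi * K * S') ^ 2 := by
  classical
  have hπ2 : 0 < 2 * Real.pi := by positivity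
  set F : UnitAddTorus d → ℂ := fun x => (f x : ℂ) with hF_def
  have hF : IsSmooth F := hf.ofReal_comp
  set cF : (d → ℤ) → ℂ := mFourierCoeff F with hcF_def
  have hcF : RapidDecay cF := hF.rapidDecay_mFourierCoeff
  set mK : (d → ℤ) → ℝ := fun k => if |((k i : ℤ) : ℝ)| < K then (1 : ℝ) else 0 with hmK_def
  have hmK01 : ∀ k, mK k = 0 ∨ mK k = 1 := fun k => by
    by_cases h : |((k i : ℤ) : ℝ)| < K
    · right; simp [hmK_def, h]
    · left; simp [hmK_def, h]
  have hmK1 : ∀ k, |mK k| ≤ 1 := fun k => by rcases hmK01 k with h | h <;> simp [h]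
  have hmKsq : ∀ k, mK k ^ 2 = mK k := fun k => by rcases hmK01 k with h | h <;> simp [h]
  have hmK_nn : ∀ k, 0 ≤ mK k := fun k => by rcases hmK01 k with h | h <;> simp [h]
  -- the low-block synthesis
  set e : (d → ℤ) → ℂ := fun k => (mK k : ℂ) * cF k with he_def
  have he : RapidDecay e := hcF.of_norm_le_mul (C := 1) fun k => by
    rw [he_def, norm_mul, Complex.norm_real, Real.norm_eq_abs, one_mul]
    exact mul_le_of_le_one_left (norm_nonneg _) (hmK1 k)
  set Gc : UnitAddTorus d → ℂ := fourierSynth e with hGc_def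
  have hGc : IsSmooth Gc := he.isSmooth_fourierSynth
  have hGc_coeff : ∀ k, mFourierCoeff Gc k = e k := he.mFourierCoeff_fourierSynth
  set g : UnitAddTorus d → ℝ := fun x => (Gc x).re with hg_def
  have hg : IsSmooth g := FluidPDE.Torus.IsSmooth.re hGc
  -- E_low and its three identities
  set E : ℝ := ∑' k, mK k * ‖cF k‖ ^ 2 with hE_def
  have hE_nn : 0 ≤ E := tsum_nonneg fun k => mul_nonneg (hmK_nn k) (sq_nonneg _)
  have hParsG := hasSum_sq_mFourierCoeff_of_continuous hGc.continuous
  have hGnorm : ∫ x, ‖Gc x‖ ^ 2 = E := by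
    rw [← hParsG.tsum_eq, hE_def]
    refine tsum_congr fun k => ?_
    rw [hGc_coeff, he_def, norm_mul, mul_pow, Complex.norm_real, Real.norm_eq_abs, sq_abs, hmKsq]
  -- (a) `∫ f g = E`
  have hpol := FluidPDE.Torus.hasSum_conj_mFourierCoeff_mul_of_continuous hF.continuous hGc.continuous
  have hfg : ∫ x, f x * g x = E := by
    have h1 : (∫ x, conj (F x) * Gc x) = ∑' k, conj (cF k) * e k := by
      rw [← hpol.tsum_eq]; exact tsum_congr fun k => by rw [hGc_coeff]
    have h2 : ∑' k, conj (cF k) * e k = ((E : ℝ) : ℂ) := by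
      rw [hE_def, Complex.ofReal_tsum]
      refine tsum_congr fun k => ?_
      rw [he_def, ← mul_assoc, mul_comm (conj (cF k)), mul_assoc, Complex.conj_mul' (cF k)]
      push_cast
      ring
    have h3 : ∫ x, f x * g x = (∫ x, conj (F x) * Gc x).re := by
      have hint : Integrable (fun x => conj (F x) * Gc x) volume :=
        (hF.continuous.star.mul hGc.continuous).integrable_unitAddTorus
      have hre := integral_re hint
      rw [show (∫ x, conj (F x) * Gc x).re = RCLike.re (∫ x, conj (F x) * Gc x) from rfl, ← hre]
      refine integral_congr_ae (ae_of_all _ fun x => ?_)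
      simp [hF_def, hg_def, Complex.conj_ofReal]
    rw [h3, h1, h2, Complex.ofReal_re]
  -- (b) `∫ g² ≤ E`
  have hg2 : ∫ x, g x ^ 2 ≤ E := by
    rw [← hGnorm]
    refine integral_mono (hg.continuous.pow 2).integrable_unitAddTorus (hGc.continuous.norm.pow 2).integrable_unitAddTorus
      fun x => ?_
    simp only [hg_def]
    rw [← sq_abs, ← Real.norm_eq_abs]
    exact pow_le_pow_left₀ (norm_nonneg _) (Complex.abs_re_le_norm (Gc x)) 2
  -- (c) `∫ (∂ᵢ g)² ≤ (2πK)² E`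
  set e' : (d → ℤ) → ℂ := fun k => (2 * Real.pi * Complex.I * (k i)) • e k with he'_def
  have hdG : partialDeriv i Gc = fourierSynth e' := he.partialDeriv_fourierSynth_eq i
  have hnormI : ∀ k : d → ℤ, ‖(2 * Real.pi * Complex.I * (k i) : ℂ)‖ = 2 * Real.pi * |((k i : ℤ) : ℝ)| := by
    intro k
    rw [show (2 * Real.pi * Complex.I * (k i) : ℂ) = ((2 * Real.pi * ((k i : ℤ) : ℝ) : ℝ) : ℂ) * Complex.I by
      push_cast; ring, norm_mul, Complex.norm_I, mul_one, Complex.norm_real, Real.norm_eq_abs, abs_mul,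
      abs_of_pos hπ2]
  have he' : RapidDecay e' := he.of_norm_le_mul_pow (C := 2 * Real.pi) (s := 1) fun k => by
    rw [he'_def, norm_smul, pow_one, hnormI k]
    refine mul_le_mul_of_nonneg_right ?_ (norm_nonneg _)
    refine mul_le_mul_of_nonneg_left ?_ hπ2.le
    have h1 : ((k i : ℤ) : ℝ) ^ 2 ≤ freqNormSq k := sq_apply_le_freqNormSq k i
    have h2 : |((k i : ℤ) : ℝ)| ^ 2 = ((k i : ℤ) : ℝ) ^ 2 := sq_abs _
    nlinarith [abs_nonneg ((k i : ℤ) : ℝ), sq_nonneg (|((k i : ℤ) : ℝ)| - 1)]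
  have hdGc : IsSmooth (partialDeriv i Gc) := hGc.partialDeriv i
  have hParsdG := hasSum_sq_mFourierCoeff_of_continuous hdGc.continuous
  have hdG_coeff : ∀ k, mFourierCoeff (partialDeriv i Gc) k = e' k := fun k => by
    rw [hdG]; exact he'.mFourierCoeff_fourierSynth k
  have hdGnorm : ∫ x, ‖partialDeriv i Gc x‖ ^ 2 ≤ (2 * Real.pi * K) ^ 2 * E := by
    rw [← hParsdG.tsum_eq, hE_def, ← tsum_mul_left]
    have hsum : Summable fun k => (2 * Real.pi * K) ^ 2 * (mK k * ‖cF k‖ ^ 2) :=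
      ((hasSum_sq_mFourierCoeff_of_continuous hF.continuous).summable.of_nonneg_of_le
        (fun k => mul_nonneg (hmK_nn k) (sq_nonneg _))
        (fun k => mul_le_of_le_one_left (sq_nonneg _) ((hmK1 k).trans' (le_abs_self _)))).mul_left _
    refine hParsdG.summable.tsum_le_tsum (fun k => ?_) hsum
    rw [hdG_coeff]
    have hek : ‖e' k‖ = 2 * Real.pi * |((k i : ℤ) : ℝ)| * (mK k * ‖cF k‖) := by
      rw [he'_def, norm_smul, hnormI k, he_def, norm_mul, Complex.norm_real, Real.norm_eq_abs, abs_of_nonneg (hmK_nn k)]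
    rw [hek]
    rcases hmK01 k with h0 | h1
    · simp [h0]
    · have hlt : |((k i : ℤ) : ℝ)| < K := by
        by_contra hnot; simp [hmK_def, hnot] at h1
      rw [h1, one_mul, one_mul, mul_pow]
      refine mul_le_mul_of_nonneg_right ?_ (sq_nonneg _)
      exact pow_le_pow_left₀ (by positivity) (mul_le_mul_of_nonneg_left hlt.le hπ2.le) 2
  have hdg2 : ∫ x, (partialDeriv i g x) ^ 2 ≤ (2 * Real.pi * K) ^ 2 * E := by
    refine le_trans ?_ hdGnorm
    refine integral_mono ((hg.partialDeriv i).continuous.pow 2).integrable_unitAddTorus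
      (hdGc.continuous.norm.pow 2).integrable_unitAddTorus fun x => ?_
    have h := FluidPDE.Torus.partialDeriv_re hGc i x
    simp only [hg_def] at h ⊢
    rw [h, ← sq_abs, ← Real.norm_eq_abs]
    exact pow_le_pow_left₀ (norm_nonneg _) (Complex.abs_re_le_norm _) 2
  -- duality
  have hmain := hpair g hg
  rw [hfg, abs_of_nonneg hE_nn] at hmain
  have hsqE : Real.sqrt (∫ x, g x ^ 2) ≤ Real.sqrt E := Real.sqrt_le_sqrt hg2
  have hsqdE : Real.sqrt (∫ x, (partialDeriv i g x) ^ 2) ≤ 2 * Real.pi * K * Real.sqrt E := by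
    calc Real.sqrt (∫ x, (partialDeriv i g x) ^ 2) ≤ Real.sqrt ((2 * Real.pi * K) ^ 2 * E) := Real.sqrt_le_sqrt hdg2
      _ = 2 * Real.pi * K * Real.sqrt E := by rw [Real.sqrt_mul (sq_nonneg _), Real.sqrt_sq (by positivity)]
  have hE_le : E ≤ (A + 2 * Real.pi * K * S') * Real.sqrt E := by
    calc E ≤ A * Real.sqrt (∫ x, g x ^ 2) + S' * Real.sqrt (∫ x, (partialDeriv i g x) ^ 2) := hmain
      _ ≤ A * Real.sqrt E + S' * (2 * Real.pi * K * Real.sqrt E) :=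
          add_le_add (mul_le_mul_of_nonneg_left hsqE hA) (mul_le_mul_of_nonneg_left hsqdE hS')
      _ = (A + 2 * Real.pi * K * S') * Real.sqrt E := by ring
  -- `E ≤ B √E ⇒ E ≤ B²`
  have hB : 0 ≤ A + 2 * Real.pi * K * S' := by positivity
  have hsq : Real.sqrt E ≤ A + 2 * Real.pi * K * S' := by
    by_cases hE0 : Real.sqrt E = 0
    · rw [hE0]; exact hB
    · have hpos : 0 < Real.sqrt E := lt_of_le_of_ne (Real.sqrt_nonneg _) (Ne.symm hE0)
      have : Real.sqrt E * Real.sqrt E ≤ (A + 2 * Real.pi * K * S') * Real.sqrt E := by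
        rw [Real.mul_self_sqrt hE_nn]; exact hE_le
      exact le_of_mul_le_mul_right this hpos
  have hfin : E ≤ (A + 2 * Real.pi * K * S') ^ 2 := by
    calc E = (Real.sqrt E) ^ 2 := (Real.sq_sqrt hE_nn).symm
      _ ≤ (A + 2 * Real.pi * K * S') ^ 2 := pow_le_pow_left₀ (Real.sqrt_nonneg _) hsq 2
  exact hfin

/-! ## §3 The conversion -/

/-- **Eulerian conversion.**  For smooth real `w, c, q, χ` and real `p` on `T^d` with `∂ᵢc = −2π·p·w`, `|c| ≤ 1`, `q·p = 1` on
`{χ ≠ 0}`, `|χq| ≤ S`, and `K ≥ 0`: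
`Σ_{|k_i|<K} |𝓕w(k)|² ≤ ((2π)⁻¹ √∫(∂ᵢ(χq))² + K·S + √∫((1−χ)w)²)²` —
the low-horizontal-mode energy of `w = sin 2πψ` is controlled by the energy on the excised set `{χ < 1}`, the ratio
`K / inf|∂ᵢψ|` on the kept set, and the `L²` size of `∂ᵢ(χ/∂ᵢψ)` (cut-off gradient and relative chirp rate).
[cite: Grafakos2014, Prop. 3.2.7 (3)] [cite: Evans2010, App. C.2 Thm. 2] -/
theorem lowModeEnergy_le_of_phase {w c p q χ : UnitAddTorus d → ℝ} (hw : IsSmooth w) (hc : IsSmooth c)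
    (hq : IsSmooth q) (hχ : IsSmooth χ) (i : d)
    (hcw : ∀ x, partialDeriv i c x = -(2 * Real.pi) * p x * w x) (hc1 : ∀ x, |c x| ≤ 1)
    (hqp : ∀ x, χ x ≠ 0 → q x * p x = 1) {S : ℝ} (hS : ∀ x, |χ x * q x| ≤ S) {K : ℝ} (hK : 0 ≤ K) :
    ∑' k : d → ℤ, (if |((k i : ℤ) : ℝ)| < K then (1 : ℝ) else 0) * ‖mFourierCoeff (fun x => (w x : ℂ)) k‖ ^ 2 ≤
      ((2 * Real.pi)⁻¹ * Real.sqrt (∫ x, (partialDeriv i (fun y => χ y * q y) x) ^ 2) + K * S +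
        Real.sqrt (∫ x, ((1 - χ x) * w x) ^ 2)) ^ 2 := by
  have hπ : 0 < 2 * Real.pi := by positivity
  have hS0 : 0 ≤ S := (abs_nonneg _).trans (hS 0)
  have h1χw : IsSmooth (fun x => (1 - χ x) * w x) := by
    have h1 : IsSmooth (fun x : UnitAddTorus d => (1 : ℝ) - χ x) := (isSmooth_const (1 : ℝ)).sub hχ
    unfold IsSmooth at h1 hw ⊢; exact h1.mul hw
  set A : ℝ := (2 * Real.pi)⁻¹ * Real.sqrt (∫ x, (partialDeriv i (fun y => χ y * q y) x) ^ 2) +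
      Real.sqrt (∫ x, ((1 - χ x) * w x) ^ 2) with hA_def
  set S' : ℝ := (2 * Real.pi)⁻¹ * S with hS'_def
  have hA0 : 0 ≤ A := by positivity
  have hS'0 : 0 ≤ S' := by positivity
  have hpair : ∀ g : UnitAddTorus d → ℝ, IsSmooth g →
      |∫ x, w x * g x| ≤ A * Real.sqrt (∫ x, g x ^ 2) + S' * Real.sqrt (∫ x, (partialDeriv i g x) ^ 2) := by
    intro g hg
    -- split `w = χ w + (1 − χ) w`
    have hi1 : Integrable (fun x => χ x * w x * g x) volume :=
      ((hχ.continuous.mul hw.continuous).mul hg.continuous).integrable_unitAddTorus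
    have hi2 : Integrable (fun x => (1 - χ x) * w x * g x) volume :=
      (h1χw.continuous.mul hg.continuous).integrable_unitAddTorus
    have hsplit : ∫ x, w x * g x = (∫ x, χ x * w x * g x) + ∫ x, (1 - χ x) * w x * g x := by
      rw [← integral_add hi1 hi2]; exact integral_congr_ae (ae_of_all _ fun x => by ring)
    have hA' := abs_integral_phase_mul_le hc hq hχ hg i hcw hc1 hqp hS
    have hB : |∫ x, (1 - χ x) * w x * g x| ≤ Real.sqrt (∫ x, ((1 - χ x) * w x) ^ 2) * Real.sqrt (∫ x, g x ^ 2) := by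
      rw [abs_le]
      constructor
      · have h := integral_mul_le_sqrt_mul_sqrt (f := fun x => -((1 - χ x) * w x)) (g := g) h1χw.continuous.neg
          hg.continuous
        have e1 : ∫ x, -((1 - χ x) * w x) * g x = -∫ x, (1 - χ x) * w x * g x := by
          rw [← integral_neg]; exact integral_congr_ae (ae_of_all _ fun x => by ring)
        have e2 : ∫ x, (-((1 - χ x) * w x)) ^ 2 = ∫ x, ((1 - χ x) * w x) ^ 2 :=
          integral_congr_ae (ae_of_all _ fun x => by ring)
        rw [e1, e2] at h; linarith
      · exact integral_mul_le_sqrt_mul_sqrt h1χw.continuous hg.continuous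
    rw [hsplit]
    calc |(∫ x, χ x * w x * g x) + ∫ x, (1 - χ x) * w x * g x|
        ≤ |∫ x, χ x * w x * g x| + |∫ x, (1 - χ x) * w x * g x| := abs_add_le _ _
      _ ≤ (2 * Real.pi)⁻¹ * (Real.sqrt (∫ x, (partialDeriv i (fun y => χ y * q y) x) ^ 2) * Real.sqrt (∫ x, g x ^ 2) +
            S * Real.sqrt (∫ x, (partialDeriv i g x) ^ 2)) +
          Real.sqrt (∫ x, ((1 - χ x) * w x) ^ 2) * Real.sqrt (∫ x, g x ^ 2) := add_le_add hA' hB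
      _ = A * Real.sqrt (∫ x, g x ^ 2) + S' * Real.sqrt (∫ x, (partialDeriv i g x) ^ 2) := by
          rw [hA_def, hS'_def]; ring
  have h := lowModeEnergy_le_of_pairing hw i hK hA0 hS'0 hpair
  have heq : A + 2 * Real.pi * K * S' =
      (2 * Real.pi)⁻¹ * Real.sqrt (∫ x, (partialDeriv i (fun y => χ y * q y) x) ^ 2) + K * S +
        Real.sqrt (∫ x, ((1 - χ x) * w x) ^ 2) := by
    rw [hA_def, hS'_def]
    field_simp
    ring
  rw [heq] at h
  exact h

end Summit.AnomalousDissipation.AnomalousDissipation.Theorems.SawtoothPulseCascade.K1Lagr
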